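import Mathlib
import Summits.Ventures.PercRepro.TriangleCapOneTriangleNineB

/-!
# PercRepro — THE CELL `(8, 13)`, PART E: ONE TRIANGLE WITHOUT AN OUTER VERTEX (p3, gen 37; part 77)

`S = {u, v, w}` the only triangle, every vertex off `S` adjacent to exactly one of `u, v, w`, `k = 8`, `m = 13`
(so `|Sᶜ| = 5`, `Q′ = 10`).  As at `(9, 16)`: `Σ deficit ≥ 2|Sᶜ| + 2(|Sᶜ|² − Σ d_x² − Q′) + Q′ + B`, where now the
block `Sᶜ × Sᶜ` of the far count of `Sᶜ` is kept: `B ≥ |Sᶜ| Q′ − 2 Σ_{y ∉ S} d(y)²`.  Two private sets adjacent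
vertices `y, y′` of `Sᶜ` have disjoint neighbourhoods there (no triangle off `S`), so `d(y) + d(y′) ≤ 5` and
`2 Σ d(y)² ≤ 5 Q′ = 50`; the private degrees `(d_u, d_v, d_w)` partition `5` with `Σ d_x² ≤ 15`; the partition
`(3, 2, 0)` (where `Σ d_x² = 13`) needs one more unit: its `3`-side has a vertex of degree `1` into `Sᶜ`, so
`Σ_{3-side} d² ≤ 9`, `Σ_{2-side} d² ≤ 13`, `Σ d(y)² ≤ 22`.  In every case
`Σ deficit ≥ 100 − 2 Σ d_x² − 2 Σ d(y)² ≥ 26 = 4k − 6`.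

* **`one_triangle_eight_thirteen_no_outer`** — `Σ_v d(v)² + 10 ≤ 104`.
Axioms: standard.
-/

namespace PercRepro

namespace TriangleCap

namespace C047

open Finset

variable {V : Type*} [Fintype V] [DecidableEq V]

omit [Fintype V] [DecidableEq V] in
/-- Three numbers `≤ 2` summing to `5` have `Σ d² ≤ 9`. -/
theorem sq_three_two (a b c : ℕ) (ha : a ≤ 2) (hb : b ≤ 2) (hc : c ≤ 2) (h : a + (b + c) = 5) :
    a * a + (b * b + c * c) ≤ 9 := by
  have hc' : c = 5 - a - b := by omega
  subst hc'
  interval_cases a <;> interval_cases b <;> omega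

omit [Fintype V] [DecidableEq V] in
/-- Two numbers `≤ 3` summing to `5` have `Σ d² ≤ 13`. -/
theorem sq_two_three (a b : ℕ) (ha : a ≤ 3) (hb : b ≤ 3) (h : a + b = 5) : a * a + b * b ≤ 13 := by
  have hb' : b = 5 - a := by omega
  subst hb'
  interval_cases a <;> omega

omit [Fintype V] [DecidableEq V] in
/-- A partition `a + b + c = 5` with `10 ≤ Σ a (5 − a)` has `Σ a² ≤ 15`. -/
theorem partition_sq_le_fifteen (a b c : ℕ) (h : a + (b + c) = 5)
    (h2 : 10 ≤ a * (5 - a) + (b * (5 - b) + c * (5 - c))) : a * a + (b * b + c * c) ≤ 15 := by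
  have hc' : c = 5 - a - b := by omega
  subst hc'
  have h1 : a ≤ 5 := by omega
  have h2' : b ≤ 5 := by omega
  interval_cases a <;> interval_cases b <;> omega

omit [Fintype V] [DecidableEq V] in
/-- The partition arithmetic of `(8, 13)`: `a + b + c = 5`, `Σ d_x² ≤ 15`, and the square sum `sq` of the
private graph `≤ 25`, or `≤ 22` when the partition is of type `(3, 2, 0)`. -/
theorem arith_eight_thirteen (a b c sq Def : ℕ) (h : a + (b + c) = 5) (h15 : a * a + (b * b + c * c) ≤ 15)
    (hsq : sq ≤ 25) (hsq' : (a = 3 ∧ b = 2) ∨ (a = 3 ∧ c = 2) ∨ (b = 3 ∧ a = 2) ∨ (b = 3 ∧ c = 2) ∨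
      (c = 3 ∧ a = 2) ∨ (c = 3 ∧ b = 2) → sq ≤ 22)
    (hD : 100 ≤ Def + 2 * (a * a + (b * b + c * c)) + 2 * sq) : 26 ≤ Def := by
  have hc' : c = 5 - a - b := by omega
  subst hc'
  have h1 : a ≤ 5 := by omega
  have h2 : b ≤ 5 := by omega
  interval_cases a <;> interval_cases b <;> omega

omit [Fintype V] in
/-- The block `A × A` of the far count of `A`: `|A| · Σ_{y ∈ A} degIn A y ≤ block + 2 Σ_{y ∈ A} (degIn A y)²`. -/
theorem block_inside_self (D : SimpleGraph V) [DecidableRel D.Adj] (A : Finset V) :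
    A.card * ∑ y ∈ A, degIn D A y ≤
      (∑ y ∈ A, ∑ y' ∈ A, if D.Adj y y' then (A.filter (fun t => ¬ D.Adj y t ∧ ¬ D.Adj y' t)).card else 0) +
      2 * ∑ y ∈ A, degIn D A y * degIn D A y := by
  have hsum : (∑ y ∈ A, ∑ y' ∈ A, if D.Adj y y' then A.card else 0) ≤
      (∑ y ∈ A, ∑ y' ∈ A, if D.Adj y y' then (A.filter (fun t => ¬ D.Adj y t ∧ ¬ D.Adj y' t)).card else 0) +
      (∑ y ∈ A, ∑ y' ∈ A, if D.Adj y y' then degIn D A y else 0) +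
      (∑ y ∈ A, ∑ y' ∈ A, if D.Adj y y' then degIn D A y' else 0) := by
    rw [← sum_add_distrib, ← sum_add_distrib]
    apply sum_le_sum
    intro y _
    rw [← sum_add_distrib, ← sum_add_distrib]
    apply sum_le_sum
    intro y' _
    by_cases h : D.Adj y y'
    · simp only [h, if_true]
      exact card_le_card_far_add D A y y'
    · simp [h]
  have e1 : (∑ y ∈ A, ∑ y' ∈ A, if D.Adj y y' then A.card else 0) = A.card * ∑ y ∈ A, degIn D A y := by
    rw [double_sum_ite_left, mul_sum]
    apply sum_congr rfl
    intro y _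
    ring
  have e2 : (∑ y ∈ A, ∑ y' ∈ A, if D.Adj y y' then degIn D A y else 0) = ∑ y ∈ A, degIn D A y * degIn D A y := by
    rw [double_sum_ite_left]
  have e3 : (∑ y ∈ A, ∑ y' ∈ A, if D.Adj y y' then degIn D A y' else 0) =
      ∑ y ∈ A, degIn D A y * degIn D A y := by
    rw [double_sum_ite_right]
  omega

omit [Fintype V] in
/-- Mantel's degree-square bound inside `A` when no triangle has two vertices in `A`: `2 Σ_{y ∈ A} (degIn A y)² ≤
|A| · Σ_{y ∈ A} degIn A y`. -/
theorem two_mul_sum_sq_le_of_no_triangle (D : SimpleGraph V) [DecidableRel D.Adj] (A : Finset V)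
    (hnotri : ∀ y ∈ A, ∀ y' ∈ A, ∀ t ∈ A, D.Adj y y' → D.Adj y t → D.Adj y' t → False) :
    2 * ∑ y ∈ A, degIn D A y * degIn D A y ≤ A.card * ∑ y ∈ A, degIn D A y := by
  have hpt : ∀ y ∈ A, ∀ y' ∈ A, D.Adj y y' → degIn D A y + degIn D A y' ≤ A.card := by
    intro y hy y' hy' hyy'
    have hdisj : Disjoint (A.filter (fun t => D.Adj y t)) (A.filter (fun t => D.Adj y' t)) := by
      rw [disjoint_left]
      intro t h1 h2
      rw [mem_filter] at h1 h2
      exact hnotri y hy y' hy' t h1.1 hyy' h1.2 h2.2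
    have := card_le_card (union_subset (filter_subset _ _) (filter_subset _ _) :
      A.filter (fun t => D.Adj y t) ∪ A.filter (fun t => D.Adj y' t) ⊆ A)
    rw [card_union_of_disjoint hdisj] at this
    exact this
  have hsum : (∑ y ∈ A, ∑ y' ∈ A, if D.Adj y y' then degIn D A y else 0) +
      (∑ y ∈ A, ∑ y' ∈ A, if D.Adj y y' then degIn D A y' else 0) ≤
      ∑ y ∈ A, ∑ y' ∈ A, if D.Adj y y' then A.card else 0 := by
    rw [← sum_add_distrib]
    apply sum_le_sum
    intro y hy
    rw [← sum_add_distrib]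
    apply sum_le_sum
    intro y' hy'
    by_cases h : D.Adj y y'
    · simp only [h, if_true]
      exact hpt y hy y' hy' h
    · simp [h]
  rw [double_sum_ite_left, double_sum_ite_right, double_sum_ite_left] at hsum
  have e : ∑ y ∈ A, degIn D A y * A.card = A.card * ∑ y ∈ A, degIn D A y := by
    rw [mul_sum]; apply sum_congr rfl; intro y _; ring
  omega

/-- **THE PARTITION `(3, 2, 0)`:** with `degIn Sᶜ p = 3`, `degIn Sᶜ q = 2`, `degIn Sᶜ r = 0` (`S = {p, q, r}`), every
vertex off `S` adjacent to exactly one of `p, q, r`, no triangle with a vertex off `S`, and `Q′ = 10`: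
`Σ_{y ∉ S} (degIn Sᶜ y)² ≤ 22`. -/
theorem sum_sq_le_twentytwo (D : SimpleGraph V) [DecidableRel D.Adj] (S : Finset V) {p q r : V}
    (hS : S = {p, q, r}) (hpq : p ≠ q) (hpr : p ≠ r) (hqr : q ≠ r)
    (hone : ∀ y ∈ Sᶜ, degIn D S y = 1)
    (hnotri : ∀ y, y ∉ S → ∀ y' t, D.Adj y y' → D.Adj y t → D.Adj y' t → False)
    (hp : degIn D Sᶜ p = 3) (hq : degIn D Sᶜ q = 2) (hr : degIn D Sᶜ r = 0)
    (hQ' : ∑ y ∈ Sᶜ, degIn D Sᶜ y = 10) :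
    ∑ y ∈ Sᶜ, degIn D Sᶜ y * degIn D Sᶜ y ≤ 22 := by
  set Pp := Sᶜ.filter (fun y => D.Adj p y) with hPp
  set Pq := Sᶜ.filter (fun y => D.Adj q y) with hPq
  have hpS : p ∈ S := by rw [hS]; simp
  have hqS : q ∈ S := by rw [hS]; simp
  have hrS : r ∈ S := by rw [hS]; simp
  -- `r` has no neighbour off `S`
  have hrno : ∀ y ∈ Sᶜ, ¬ D.Adj r y := by
    intro y hy hry
    have : 0 < degIn D Sᶜ r := card_pos.mpr ⟨y, mem_filter.mpr ⟨hy, hry⟩⟩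
    omega
  -- every `y ∉ S` lies in `Pp` or `Pq`, and not both
  have hcover : ∀ y ∈ Sᶜ, y ∈ Pp ∨ y ∈ Pq := by
    intro y hy
    have h1 := hone y hy
    unfold degIn at h1
    obtain ⟨t, ht⟩ := card_pos.mp (by omega : 0 < (S.filter (fun t => D.Adj y t)).card)
    rw [mem_filter, hS] at ht
    simp only [mem_insert, mem_singleton] at ht
    rcases ht.1 with rfl | rfl | rfl
    · exact Or.inl (mem_filter.mpr ⟨hy, ht.2.symm⟩)
    · exact Or.inr (mem_filter.mpr ⟨hy, ht.2.symm⟩)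
    · exact absurd ht.2.symm (hrno y hy)
  have hdisj : Disjoint Pp Pq := by
    rw [disjoint_left]
    intro y h1 h2
    rw [hPp, mem_filter] at h1
    rw [hPq, mem_filter] at h2
    have h := hone y h1.1
    unfold degIn at h
    have := card_le_one.mp h.le p (mem_filter.mpr ⟨hpS, h1.2.symm⟩) q (mem_filter.mpr ⟨hqS, h2.2.symm⟩)
    exact hpq this
  have hunion : Sᶜ = Pp ∪ Pq := by
    ext y
    constructor
    · intro hy
      rw [mem_union]
      exact hcover y hy
    · intro hy
      rw [mem_union] at hy
      rcases hy with hy | hy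
      · exact (mem_filter.mp hy).1
      · exact (mem_filter.mp hy).1
  have hPpS : Pp ⊆ Sᶜ := filter_subset _ _
  have hPqS : Pq ⊆ Sᶜ := filter_subset _ _
  -- the neighbours off `S` of a vertex of `Pp` lie in `Pq`, and conversely
  have hnbrp : ∀ y ∈ Pp, Sᶜ.filter (fun t => D.Adj y t) = Pq.filter (fun t => D.Adj y t) := by
    intro y hy
    ext t
    rw [mem_filter, mem_filter]
    constructor
    · rintro ⟨ht, hyt⟩
      refine ⟨?_, hyt⟩
      rcases hcover t ht with h | h
      · exfalso
        rw [hPp, mem_filter] at hy h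
        exact hnotri y (mem_compl.mp hy.1) t p hyt hy.2.symm h.2.symm
      · exact h
    · rintro ⟨ht, hyt⟩
      exact ⟨hPqS ht, hyt⟩
  have hnbrq : ∀ y ∈ Pq, Sᶜ.filter (fun t => D.Adj y t) = Pp.filter (fun t => D.Adj y t) := by
    intro y hy
    ext t
    rw [mem_filter, mem_filter]
    constructor
    · rintro ⟨ht, hyt⟩
      refine ⟨?_, hyt⟩
      rcases hcover t ht with h | h
      · exact h
      · exfalso
        rw [hPq, mem_filter] at hy h
        exact hnotri y (mem_compl.mp hy.1) t q hyt hy.2.symm h.2.symm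
    · rintro ⟨ht, hyt⟩
      exact ⟨hPpS ht, hyt⟩
  -- the degree sums on the two sides agree, so each is `5`
  have hsame : ∑ y ∈ Pp, degIn D Sᶜ y = ∑ y ∈ Pq, degIn D Sᶜ y := by
    have e1 : ∑ y ∈ Pp, degIn D Sᶜ y = ∑ y ∈ Pp, degIn D Pq y := by
      apply sum_congr rfl
      intro y hy
      unfold degIn
      rw [hnbrp y hy]
    have e2 : ∑ y ∈ Pq, degIn D Sᶜ y = ∑ y ∈ Pq, degIn D Pp y := by
      apply sum_congr rfl
      intro y hy
      unfold degIn
      rw [hnbrq y hy]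
    rw [e1, e2, sum_degIn_comm]
  have hsplit : ∀ f : V → ℕ, ∑ y ∈ Sᶜ, f y = ∑ y ∈ Pp, f y + ∑ y ∈ Pq, f y := fun f => by
    rw [← sum_union hdisj, ← hunion]
  rw [hsplit] at hQ'
  have h5p : ∑ y ∈ Pp, degIn D Sᶜ y = 5 := by omega
  have h5q : ∑ y ∈ Pq, degIn D Sᶜ y = 5 := by omega
  -- the cardinalities of the two sides
  have hPpc : Pp.card = 3 := hp
  have hPqc : Pq.card = 2 := hq
  -- degrees: at most `2` on `Pp`, at most `3` on `Pq`
  have hdp : ∀ y ∈ Pp, degIn D Sᶜ y ≤ 2 := by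
    intro y hy
    unfold degIn
    rw [hnbrp y hy]
    have := card_filter_le Pq (fun t => D.Adj y t)
    omega
  have hdq : ∀ y ∈ Pq, degIn D Sᶜ y ≤ 3 := by
    intro y hy
    unfold degIn
    rw [hnbrq y hy]
    have := card_filter_le Pp (fun t => D.Adj y t)
    omega
  -- name the elements
  obtain ⟨y1, y2, y3, h12, h13, h23, hPpe⟩ := card_eq_three.mp hPpc
  obtain ⟨z1, z2, hz12, hPqe⟩ := card_eq_two.mp hPqc
  have hy1 : y1 ∈ Pp := by rw [hPpe]; simp
  have hy2 : y2 ∈ Pp := by rw [hPpe]; simp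
  have hy3 : y3 ∈ Pp := by rw [hPpe]; simp
  have hz1 : z1 ∈ Pq := by rw [hPqe]; simp
  have hz2 : z2 ∈ Pq := by rw [hPqe]; simp
  have ep : ∀ (f : V → ℕ), ∑ y ∈ Pp, f y = f y1 + (f y2 + f y3) := by
    intro f
    rw [hPpe, sum_insert, sum_insert, sum_singleton]
    · simp only [mem_singleton]; exact h23
    · simp only [mem_insert, mem_singleton, not_or]; exact ⟨h12, h13⟩
  have eq' : ∀ (f : V → ℕ), ∑ y ∈ Pq, f y = f z1 + f z2 := by
    intro f
    rw [hPqe, sum_insert, sum_singleton]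
    simp only [mem_singleton]; exact hz12
  rw [hsplit, ep, eq']
  rw [ep] at h5p
  rw [eq'] at h5q
  have a1 := sq_three_two _ _ _ (hdp y1 hy1) (hdp y2 hy2) (hdp y3 hy3) h5p
  have a2 := sq_two_three _ _ (hdq z1 hz1) (hdq z2 hz2) h5q
  omega

end C047

end TriangleCap

end PercRepro
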